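import Summits.PneNP.PneNP.Theses.KrwChromaticSteering
import Summits.PneNP.PneNP.Cruxes.StrongComposition.Disproof

/-!
# Sketch — crux idea `inner-fraction-door` for stmt-PneNP-18538 (StrongComposition)

Barrier-inversion lens: the recorded walls of `StrongComposition` (∀g dictator wall, antisymmetric-∀g wall,
Gaskov–Lozhkin O(1)-loss wall, non-constancy wall) are all statements about the GAIN `+ n` with small LOSS.
The deciding theorem `closes` consumes `StrongComposition` only through weak KRW, and the printed iteration
(GMWW 2017 fn. 3 (ii)) needs only a constant FRACTION of the inner depth per level.  The door below is the
crux re-typed just outside the "full inner gain" class; `closes_frac` certifies that it still decides the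
sub-problem once the fractional iteration `CompositionIterationFrac` (first lemma, unproved here) is supplied.
-/

namespace Summit.PneNP.PneNP.Cruxes.StrongComposition.InnerFractionDoor

open Literature.Computability.Complexity

/-- DOOR (inner-fraction strong composition): some `g` makes every strong-composition tree pay a
`1/k` fraction of the inner depth on top of a `KW_f` tree, up to `c·(⌊log₂(mn)⌋+1)`. -/
def StrongCompositionFrac : Prop :=
  ∃ c k : ℕ, 0 < k ∧ ∀ m n : ℕ, 1 ≤ n → ∀ f : (Fin m → Bool) → Bool, (∃ a b, f a ≠ f b) →
    ∃ g : (Fin n → Bool) → Bool, ∀ P : KWTree (Fin m × Fin n), P.SolvesStrong f g →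
      ∃ Q : KWTree (Fin m), Q.Solves f ∧ Q.depth + n / k ≤ P.depth + c * (Nat.log 2 (m * n) + 1)

/-- The crux as typed implies the door (`k = 1`). -/
theorem strongCompositionFrac_of_strongComposition
    (h : Summit.PneNP.PneNP.Theses.KrwChromaticSteering.StrongComposition) :
    StrongCompositionFrac := by
  obtain ⟨c, hc⟩ := h
  refine ⟨c, 1, Nat.one_pos, fun m n hn f hf => ?_⟩
  obtain ⟨g, hg⟩ := hc m n hn f hf
  refine ⟨g, fun P hP => ?_⟩
  obtain ⟨Q, hQ, hd⟩ := hg P hP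
  exact ⟨Q, hQ, by simpa using hd⟩

/-- Weak KRW in depth form with a constant fraction `n / k` of the inner depth gained. -/
def WeakKRWFrac : Prop :=
  ∃ c k : ℕ, 0 < k ∧ ∀ m n : ℕ, 1 ≤ n → ∀ f : (Fin m → Bool) → Bool, (∃ a b, f a ≠ f b) →
    ∃ g : (Fin n → Bool) → Bool, ∀ P : KWTree (Fin m × Fin n), P.Solves (blockComp f g) →
      ∃ Q : KWTree (Fin m), Q.Solves f ∧ Q.depth + n / k ≤ P.depth + c * (Nat.log 2 (m * n) + 1)

/-- Door + Meir's first obstacle (`StandardFromStrong`, item 18539 unchanged) give fractional weak KRW;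
the proof is the route's `closes` composition verbatim. -/
theorem weakKRWFrac_of (h1 : StrongCompositionFrac)
    (h2 : Summit.PneNP.PneNP.Theses.KrwChromaticSteering.StandardFromStrong) : WeakKRWFrac := by
  obtain ⟨c₁, k, hk, h1⟩ := h1
  obtain ⟨c₂, h2⟩ := h2
  refine ⟨c₁ + c₂, k, hk, fun m n hn f hf => ?_⟩
  obtain ⟨g, hg⟩ := h1 m n hn f hf
  obtain ⟨g₀, hg₀⟩ := h2 m n hn f hf
  refine ⟨g₀, fun P hP => ?_⟩
  obtain ⟨P', hP', hd'⟩ := hg₀ g P hP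
  obtain ⟨Q, hQ, hd⟩ := hg P' hP'
  refine ⟨Q, hQ, ?_⟩
  have hsplit : (c₁ + c₂) * (Nat.log 2 (m * n) + 1)
      = c₁ * (Nat.log 2 (m * n) + 1) + c₂ * (Nat.log 2 (m * n) + 1) := by
    ring
  generalize n / k = q at hd ⊢
  omega

/-- FIRST LEMMA of the line (to be proved by adapting `Theorems/KrwChromaticSteeringCompositionIteration*`:
`d ≈ k·(c₀+1)` levels instead of `c₀+1`, inner arity `K = 2^t` with `(c·d² + c₀·d)(t+1) < d·(2^t / k) − …`):
fractional weak KRW already separates P from non-uniform NC¹ (GMWW 2017, footnote 3 (ii)). -/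
def CompositionIterationFrac : Prop :=
  WeakKRWFrac → ∃ L ∈ Classes.P, L ∉ NC1

/-- The re-glued deciding theorem: with the support item `CompositionIterationFrac` in place of
`CompositionIteration`, the door decides the sub-problem exactly as `closes` does. -/
theorem closes_frac (h1 : StrongCompositionFrac)
    (h2 : Summit.PneNP.PneNP.Theses.KrwChromaticSteering.StandardFromStrong)
    (s3 : CompositionIterationFrac)
    (hR : Summit.PneNP.PneNP.Theses.KrwChromaticSteering.FormulaLayerLift) : PneNP := by
  refine hR fun hsub => ?_
  obtain ⟨L, hLP, hLNC⟩ := s3 (weakKRWFrac_of h1 h2)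
  exact hLNC (hsub hLP)

/-- RUNG IN PRINT (witness that the door is strictly weaker than the crux where anything is known):
in the small-outer regime `2m ≤ n` the door with `k = 51` follows from Meir's theorem
(`Literature.Computability.Complexity.MeirStrongComposition`, Meir 2023 Thm 3.1 with γ = 1/25:
`log₂ L(KW_f) + n ≤ depth P + 24m/25 + c·L`) and the trivial `KW_f` protocol of depth `m + ⌈log₂ m⌉ + 1`
(Alice sends `a`, Bob names a differing coordinate): `depth P ≥ 13n/25 − c·L` while
`m + log₂ m + 1 + n/51 ≤ 0.5197·n + log₂ n + 1`.  The crux itself (gain `n`, outer term `D(f)` with no loss)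
is NOT known in this regime.  Unproved here (needs the trivial-protocol construction via `bobChoose`). -/
def DoorSmallOuter : Prop :=
  ∃ c : ℕ, ∀ m n : ℕ, 1 ≤ n → 2 * m ≤ n → ∀ f : (Fin m → Bool) → Bool, (∃ a b, f a ≠ f b) →
    ∃ g : (Fin n → Bool) → Bool, ∀ P : KWTree (Fin m × Fin n), P.SolvesStrong f g →
      ∃ Q : KWTree (Fin m), Q.Solves f ∧ Q.depth + n / 51 ≤ P.depth + c * (Nat.log 2 (m * n) + 1)

/-- PROVED RUNG: Meir's theorem (named Literature fact, γ = 1/25) gives the door with `k = 51` in the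
small-outer regime `2m ≤ n`, using the trivial `KW_f` protocol `exists_solves_sendInput` of Disproof.lean.
Arithmetic: `49m/25 + n/51 ≤ 49n/50 + n/51 < n`, and `⌊log₂ m⌋ + 1 ≤ ⌊log₂(mn)⌋ + 1` is one extra unit
of the constant. -/
theorem doorSmallOuter_of_meir (hM : MeirStrongComposition) : DoorSmallOuter := by
  obtain ⟨c, hM⟩ := hM
  refine ⟨c + 1, fun m n hn hmn f hf => ?_⟩
  obtain ⟨g, hg⟩ := hM m n hn f hf
  refine ⟨g, fun P hP => ?_⟩
  obtain ⟨Qs, -, hQs⟩ := hg P hP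
  have hm : 1 ≤ m := Disproof.one_le_of_nonconst hf
  obtain ⟨Q₀, hQ₀, hQ₀d⟩ := Disproof.exists_solves_sendInput hm f
  refine ⟨Q₀, hQ₀, ?_⟩
  have hlog : Nat.log 2 m ≤ Nat.log 2 (m * n) :=
    Nat.log_mono_right (Nat.le_mul_of_pos_right m hn)
  have hsplit : (c + 1) * (Nat.log 2 (m * n) + 1)
      = c * (Nat.log 2 (m * n) + 1) + (Nat.log 2 (m * n) + 1) := by
    ring
  generalize Nat.log 2 (m * n) = L at *
  generalize Nat.log 2 m = lm at *
  generalize Nat.log 2 Qs.leafCount = lq at *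
  omega

end Summit.PneNP.PneNP.Cruxes.StrongComposition.InnerFractionDoor
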